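import Mathlib
import HarnessLib
import HarnessLib.Audit
import Summits.AtomisticToContinuum.Statement
import Literature.MathematicalPhysics.StatisticalMechanics.LennardJonesClusters
import Literature.MathematicalPhysics.StatisticalMechanics.HaggStacking
import Literature.MathematicalPhysics.StatisticalMechanics.BarlowStacking
import Literature.MathematicalPhysics.StatisticalMechanics.BarlowStackingEnergy
import Summits.AtomisticToContinuum.Crystallization.Theorems.ExcessDecayLiouvilleCrysEnergyLimit
import Summits.AtomisticToContinuum.Crystallization.Theorems.ThreeConeCertificateDefectVanishCrystallizes
import HarnessLib.Audit.Status.Attr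

/-!
Route: PoissonBesselStacking

DORMANT since 2026-08-23T18:52:14Z (reconciler: no traction for 6.2 d (last activity item-evidence-added at 2026-08-17T14:17:50Z); parked, not closed — `ledger route dormant route-AtomisticToContinuum-PoissonBesselStacking --off` to rea) — unstaffed, not closed; items shared with open routes are served there. `ledger route dormant <id> --off` reactivates.

# Route PoissonBesselStacking — Poisson–Bessel stacking selection — LJ registry couplings are
sign-definite exponential Bessel tails, so relaxed HCP is the periodic minimiser

Realises idea card poisson-bessel-stacking-selection. It suffices to show X = X_E ∧ X_P for
Lennard-Jones V = r⁻¹²/12 − r⁻⁶/6 in ℝ³, with the relaxation box B = {(a,h) : 0.94 ≤ a ≤ 1, 0.78 ≤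
h/a ≤ 0.85} (in-layer spacing a, layer spacing h):
X_E (energetic half, target HcpPeriodicMinimiser): a relaxed HCP stacking hcpPeriodicConfiguration a
h with (a,h) ∈ B attains the minimum of the energy per particle over ALL periodic configurations of
ℝ³. It follows from two cruxes and glue: (R) PeriodicReductionToBarlow — every periodic
configuration is energetically matched by a uniform Barlow stacking with parameters in B (the 3-D
layering content); (D) LjRegistryDomination — on B the interlayer registry couplings J_k(a,h) =
barlowCoupling lennardJones a h k satisfy J₂ < 0 and Σ_{k≥3}(k−1)|J_k| ≤ |J₂|/2 (numerically the
ratio is ≥ 287), which is exactly the hypothesis of the in-tree Peierls count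
HaggDominationAllRanges (0737) forcing the period-2 (ABAB) Hägg sequence; the ENGINE for (D) is
two-dimensional Poisson summation in each layer, which turns J_k into a modified-Bessel series over
the dual lattice, J_k = (9/covol)·φ̂_{kh}(ξ₁) + O(φ̂_{kh}(2ξ₁)), |ξ₁| = 2/(√3 a), so that J_k is
NEGATIVE for every k ≥ 2 and |J_k| ≍ e^{−2π h|ξ₁| k} = e^{−5.9k} (support
RegistryCouplingBesselTail), and the k = 1 term locks adjacent layers into the deep holes (crux
AdjacentLayerHoleLocking).
X_P (positional half): BulkDefectVanish (shared with CrystalKissingRigidity, 0751) — all but o(N)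
particles of a ground state see, in every fixed window, an isometric copy of one periodic
configuration (here: the relaxed HCP selected by (D), each stacking fault costing ≥ |J₂|/2 >
1.8·10⁻⁵ per column).
Given X: E(N)/N → e(HCP) by the bookkeeping limit CrysEnergyLimit (0626) and IsLeast.csInf_eq;
IsCrystallizing by DefectVanishCrystallizes (0752) and the discharged fact
LennardJonesMinimalDistance; hence Crystallization.
Lean: `(∃ a h : ℝ, ∃ (ha : a ≠ 0) (hh : h ≠ 0), 47 / 50 ≤ a ∧ a ≤ 1 ∧ 39 / 50 * a ≤ h ∧ h ≤ 17 / 20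
* a ∧ IsLeast (Set.range fun Q :
Literature.MathematicalPhysics.StatisticalMechanics.PeriodicConfiguration 3 => Q.energyPerParticle
Literature.MathematicalPhysics.StatisticalMechanics.lennardJones)
((Literature.MathematicalPhysics.StatisticalMechanics.hcpPeriodicConfiguration ha
hh).energyPerParticle Literature.MathematicalPhysics.StatisticalMechanics.lennardJones)) ∧ (∃ P :
Literature.MathematicalPhysics.StatisticalMechanics.PeriodicConfiguration 3, ∀ R ε : ℝ, 0 < R → 0 <
ε → ∀ x : (N : ℕ) → (Fin N → EuclideanSpace ℝ (Fin 3)), (∀ N,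
Literature.MathematicalPhysics.StatisticalMechanics.IsGroundState
Literature.MathematicalPhysics.StatisticalMechanics.lennardJones (x N)) → Filter.Tendsto (fun N : ℕ
=> (Nat.card {i : Fin N // ¬ ∃ A : EuclideanSpace ℝ (Fin 3) →ₗᵢ[ℝ] EuclideanSpace ℝ (Fin 3), (∀ p ∈
P.points, ‖p‖ ≤ R → ∃ j : Fin N, dist (x N j) (x N i + A p) ≤ ε) ∧ (∀ j : Fin N, dist (x N j) (x N
i) ≤ R → ∃ p ∈ P.points, dist (x N j) (x N i + A p) ≤ ε)} : ℝ) / N) Filter.atTop (nhds 0))`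

## Assembly
Pure logic plus IsLeast.csInf_eq (checked in the planner's Sketch.lean): HcpPeriodicMinimiser
supplies P = hcpPeriodicConfiguration a h with IsLeast; CrysEnergyLimit (0626) is the Tendsto to ⨅_Q
e(Q), rewritten to e(P) by IsLeast.csInf_eq, giving HasPeriodicGroundStateEnergy;
DefectVanishCrystallizes (0752) applied to BulkDefectVanish (0751) and the discharged Literature
fact LennardJonesMinimalDistance (LennardJonesMinimalDistance_holds) gives IsCrystallizing; the
conjunction is Crystallization. The energetic half is composed separately by the support item
EnergeticGlue (PeriodicReductionToBarlow → LjRegistryDomination → HaggDominationAllRanges →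
BarlowEnergyIdentification → HcpEnergyMinOnBox → HcpPeriodicMinimiser) so that each glue statement
stays short.

Rationale: WHY THIS LINE. Every route of this sub-problem bottoms out in STACKING SELECTION — which Barlow
stacking Lennard-Jones prefers — and so far treats it as a certified 3-D interval computation
(informal items 0628/0670) or even as a possibly frustrated k⁻⁴ long-range chain (route
RefuteCrystalPeriodicMin). The classical surface-science tool of Lennard-Jones–Dent 1928 and Steele
1973 (LennardjonesDent1928, Steele1973; planewise/Bessel lattice summation, cf. BurrowsEtAl2020)
says otherwise: after 2-D Poisson summation inside a layer, the registry dependence of the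
interaction with a layer at height c is a modified-Bessel tail (2π^s/Γ(s))(ξ/c)^{s−1}K_{s−1}(2πcξ),
exponentially small in c/a and with a SIGN read off the 2-D Fourier–Abel transform of V at height c
(positive, repulsion-dominated, for c < 1.10; negative, dispersion-dominated, for c > 1.12 at a =
0.971). For Lennard-Jones this gives J₁ = +0.78 (holes lock), J₂ = −7.25·10⁻⁵, J₃ = −8.5·10⁻⁸, J₄ =
−1.1·10⁻¹⁰ (our pure-python Bessel evaluation agrees with direct lattice sums to 3·10⁻¹⁰ and with
LoachAckland2017's H₂ ≈ −0.0009ε) and Hägg domination with margin ≥ 287 uniformly on B — so the 1-D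
selection problem is a ferromagnet-strength period-2 lock, not a devil's staircase, and HCP is
selected (consistent with Stillinger2001, PartayOrtnerCsanyi2017 at p = 0). Imported areas: harmonic
analysis on lattices (Poisson summation, Bessel asymptotics; BeterminPetrache2017 proved the
completely-monotone = one-signed case), 1-D lattice-gas ground states (RadinSchulman1983; in-tree
HaggStacking), certified one-dimensional numerics for the sign of a Bessel combination. What it adds
to prior routes: typed, grounded sign/domination statements over the in-tree barlowCoupling (the
informal 0628/0670 become provable-by-hand items), the energetic reduction typed over
barlowPeriodicConfiguration, and a named periodic minimiser (relaxed HCP) instead of an anonymous ∃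
P.

RANKED CRUXES. #0 HcpPeriodicMinimiser (target) — X_E: some relaxed HCP stacking with parameters
(a,h) in the box B is a least element of the Lennard-Jones energy per particle over all periodic
configurations of ℝ³ (names the minimiser that 0627 leaves anonymous). (why it might fail: False iff
the LJ periodic ground state is not relaxed HCP: FCC wins only if J₂+J₄+… > 0 (numerics: J₂ =
−7.25e−5 < 0, Stillinger2001 hcp at p = 0); a non-close-packed or non-uniformly relaxed polytype
would have to gain > 3.6e−5 per layer.) [Stillinger2001, PartayOrtnerCsanyi2017,
BeterminSamajTravenec2022, LoachAckland2017, BlancLewin2015]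
#2 PeriodicReductionToBarlow (crux) — (R) ENERGETIC LAYERING/REDUCTION (card item (3), the genuinely
3-D content): for every periodic configuration Q of ℝ³ there are (a,h) ∈ B and a periodic Hägg
sequence s such that the uniform Barlow stacking barlowPeriodicConfiguration a h s has Lennard-Jones
energy per particle ≤ that of Q. Intended mechanism (foreseen split): near-optimal periodic Q are
twelve-coordinated stacks of triangular layers (Flyspeck L12 cap + LJ bond counting, as in
CrystalKissingRigidity K1/K2 but for PERIODIC Q, no N → ∞ defects), lateral offsets are forced into
the deep holes by AdjacentLayerHoleLocking, and layer-dependent spacings relax to a uniform h by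
convexity of h ↦ Φ_N(h) (the registry corrections are ≤ 7.3e−5 with dJ₂/dh ≈ 5e−4 against an O(10)
stiffness: non-uniform relaxation gains ≲ 1e−8 per layer). [deps: AdjacentLayerHoleLocking]
[difficulty: XL] (why it might fail: Given LjRegistryDomination it says relaxed HCP is THE periodic
LJ minimiser: false if a non-close-packed or layer-wise relaxed polytype beats every uniform Barlow
stacking in B; its proof is the periodic form of the whole energetic lower bound (Flyspeck-type
local inequality).) [BlancLewin2015, FlatleyTheil2015, Hales2012, Stillinger2001,
PartayOrtnerCsanyi2017, BeterminSamajTravenec2022]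
#3 LjRegistryDomination (crux) — (D) SIGN + HÄGG DOMINATION ON THE BOX (card items (1)-(2), the
engine's deliverable): for all (a,h) ∈ B, with J_k = barlowCoupling lennardJones a h k: Σ k|J_k| <
∞, J₂ < 0, and Σ_{k≥3} (k−1)|J_k| ≤ |J₂|/2. Numerics (ours, Bessel series cross-checked by direct
sums): worst ratio |J₂|/Σ_{k≥3}(k−1)|J_k| = 286.9 at (a,h/a) = (0.94,0.78), 428 at the HCP optimum,
max J₂ = −3.68e−5 at (1,0.85). Proof route: 2-D Poisson summation ⇒ J_k = (1/covol) Σ_{ξ∈Λ*∖0}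
φ̂_{kh}(ξ)(1 − cos 2πξ·w) with φ̂_c(ξ) = (1/12)F₆ − (1/6)F₃, F_s(c,ξ) =
(2π^s/Γ(s))(ξ/c)^{s−1}K_{s−1}(2πcξ); monotone bounds K_ν(z) ≤ √(π/2z)e^{−z}(1 + (4ν²−1)/8z + …) and
a certified sign of the one-dimensional combination at ξ₁ (Mathlib-friendlier fallback: Abel
transform + Paley–Wiener contour shift, or direct interval lattice sums with an r⁻⁶ tail bound).
This typed statement supersedes the informal certified-computation items 0628/0670 and is exactly
the hypothesis of HaggDominationAllRanges (0737). [difficulty: L] (why it might fail: Only if the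
uncertified numerics are wrong at a box corner: the margin is a factor ≥ 287 (worst at a = 0.94, h/a
= 0.78) and the sign of φ̂_c(ξ₁) flips at c ≈ 1.11 < 2h ≥ 1.466 on B; Mathlib lacks K_ν, so the
by-hand route needs the integral representation.) [LennardjonesDent1928, Steele1973,
LoachAckland2017, BeterminPetrache2017, BurrowsEtAl2020, FlatleyTheil2015, arXiv:2504.07338]
#4 BulkDefectVanish (crux) — (P) HINGE, shared verbatim with CrystalKissingRigidity (item 0751):
there is ONE periodic configuration P (here: the relaxed HCP selected by LjRegistryDomination) such
that for every window radius R and tolerance ε, in every sequence of LJ ground states all but o(N)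
particles i admit a linear isometry A with the particles in B_R(x_i) ε-matched both ways to x_i +
A(P.points ∩ B_R). In this route its stacking part is fed by the engine: each misaligned layer pair
costs ≥ |J₂| − Σ_{k≥3}(k−1)|J_k| ≥ |J₂|/2 > 1.8e−5 per column (LjRegistryDomination +
HaggDominationAllRanges) against an O(N^{2/3}) surface budget, so ground states carry O(1) fault
planes; the layering part (soft twelve-coordination + robust Fejes Tóth) is CrystalKissingRigidity's
K1/K2 (0750/0758). [deps: LjRegistryDomination] [difficulty: XL] (why it might fail: Needs layering
of finite ground states (K1/K2 of CrystalKissingRigidity, unproved; ε-quasi-12-neighbour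
constructions of Böröczky–Szabó 2016 threaten K2) plus O(1) fault planes; as typed P must be
vertex-transitive — true for HCP, false for dhcp-type limits.) [Hales2012, BlancLewin2015,
PartayOrtnerCsanyi2017, FlatleyTheil2015, LucaFriesecke2016, doi:10.1007/s10474-016-0583-4]
#5 AdjacentLayerHoleLocking (crux) — (k = 1 term of the engine) For all (a,h) ∈ B the registry
potential of ONE adjacent triangular layer at height h, u ↦ Φ_h(u) = Σ_{λ∈Λ_a} V_LJ(√(|λ+u|²+h²)),
is minimised over all lateral offsets u ∈ ℝ² at the deep hole w = (a/2, a√3/6) (where it equals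
layerInteraction lennardJones a h 1 1). Poisson: Φ_h(u) = const + (1/covol)Σ_{ξ≠0} φ̂_h(ξ)cos(2πξ·u)
with φ̂_h(ξ₁) > 0 on B (repulsion-dominated at c = h ≤ 0.85 < 1.10), and the first-shell sum Σ_6
cos(2πξ·u) is minimised exactly at the two holes; numerics: argmin = hole at all four box corners
(hole −0.3874 vs bridge −0.3422 vs atop +0.29 at (0.94,0.85)). Used by PeriodicReductionToBarlow
(offsets of layered competitors) and by the positional layering. [difficulty: M] (why it might fail:
V(√(|y|²+h²)) is a DIFFERENCE of completely monotone functions of |y|²: Baernstein's theorem pulls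
the r⁻¹² part to the holes but the −r⁻⁶ part to the atop site; the second dual shell weighs ≈10% of
the first at c = h, so global (not just local) minimality needs a quantitative argument.)
[Baernstein1997, BeterminPetrache2017, LennardjonesDent1928, Steele1973]
#9 HaggDominationAllRanges (support) — shared verbatim with item 0737 (routes CrystalLocalRigidity /
RefuteCrystalPeriodicMin): the Peierls count — for Σ k|J_k| < ∞ and J₂ + Σ_{k≥3}(k−1)|J_k| ≤ 0,
every ±1 sequence s and every n satisfy n·Σ_{k≥2 even} J_k ≤ H_n(J,s) + Σ_k k|J_k| (the alternating
= HCP sequence minimises the stacking energy up to an O(1) boundary term). [difficulty: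
provable-now] [RadinSchulman1983, PartayOrtnerCsanyi2017]
#9 BarlowEnergyIdentification (support) — the regrouping left open in BarlowStackingEnergy.lean
('Not proved here'): for a, h > 0 and a p-periodic Hägg sequence s, the energy per particle
(Crystallization.lean, tsum over the point set) of barlowPeriodicConfiguration a h s equals
barlowBaseEnergy lennardJones a h + haggEnergy p (barlowCoupling lennardJones a h) s / p (absolute
summability of the LJ lattice sum, PeriodicConfigurationSums.lean, +
barlowSiteEnergy_average_eq_haggEnergy + motif card = p). [difficulty: provable-now]
[BlancLewin2015, PartayOrtnerCsanyi2017]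
#9 HcpEnergyMinOnBox (support) — continuity/compactness: (a,h) ↦ energyPerParticle lennardJones
(hcpPeriodicConfiguration a h) attains its minimum over the compact box B at some (a₀,h₀) ∈ B
(uniform convergence of the LJ lattice sums on B). [difficulty: provable-now] [BlancLewin2015,
BeterminSamajTravenec2022]
#9 EnergeticGlue (support) — glue of the energetic half: PeriodicReductionToBarlow →
LjRegistryDomination → HaggDominationAllRanges → BarlowEnergyIdentification → HcpEnergyMinOnBox →
HcpPeriodicMinimiser. Proof: for any Q take the Barlow competitor (R); by (E) its energy is e₀(a,h)
+ H_p/p; periodicity gives H_{pm} = m·H_p (haggLocalEnergy_periodic), so by (H) with the hypothesis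
supplied by (D), H_p/p ≥ Σ_{k even} J_k − Σ k|J_k|/(pm) → Σ_{k even} J_k; by (E) with
alternatingHagg (haggEnergy_alternating) this is e(hcp a h) ≥ e(hcp a₀ h₀) by (M); hcp a₀ h₀ is
itself periodic, hence IsLeast. [difficulty: S] [RadinSchulman1983, BlancLewin2015]
#9 CrysEnergyLimit (support) — shared verbatim with item 0626 (route CrystalLocalRigidity): E(N)/N →
⨅ over periodic configurations of the LJ energy per particle — thermodynamic-limit bookkeeping
(periodisation 0715 gives ⨅ ≤ E(N)/N for every N; trial blocks 0629 give limsup ≤ ⨅; the limit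
exists by BlancLewin2015_8_holds). [difficulty: M] [BlancLewin2015]
#9 DefectVanishCrystallizes (support) — shared verbatim with item 0752 (route
CrystalKissingRigidity): BulkDefectVanish + the uniform minimal distance of LJ ground states ⇒
IsCrystallizing lennardJones 3 (choose good particles as centres, extract a convergent subsequence
of isometries in O(3), tendsto_sum_of_eventually_near of CrystallizationLocalLimit.lean,
isometryImage of CrystallizationSymmetries.lean). [difficulty: M] [BlancLewin2015]
#9 RegistryCouplingBesselTail (support) — the engine's structural output (refutes the 'J_k ~ k⁻⁴'
premise of RefuteCrystalPeriodicMin): for all (a,h) ∈ B and all k ≥ 2, J_k = barlowCoupling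
lennardJones a h k is NEGATIVE and |J_k| ≤ 20·exp(−(4π/√3)(h/a)k) (numerics: sup over B and 2 ≤ k ≤
12 of |J_k|e^{(4π/√3)(h/a)k} = 11.8, attained at k = 2, (a,h/a) = (0.94,0.78); the prefactor decays
like k^{−5/2}). Implies the summability and tail parts of LjRegistryDomination. Tool: 2-D Poisson
summation, FT[(|y|²+c²)^{−s}](ξ) = (2π^s/Γ(s))(|ξ|/c)^{s−1}K_{s−1}(2πc|ξ|), K_ν(z) = ∫₀^∞ e^{−z cosh
t}cosh(νt)dt. [difficulty: M] [LennardjonesDent1928, Steele1973, BurrowsEtAl2020, arXiv:2504.07338]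

TWO-LAYER PLAN. Foreseen glued splits (none filed now): PeriodicReductionToBarlow ⇐ PeriodicLayering
(every periodic Q with e(Q) ≤ ⨅ + η₀ is, up to isometry, a stack of parallel triangular layers of
common spacing a ∈ [0.94,1] with free lateral offsets and spacings h_m ∈ [0.78a, 0.85a]) →
LayeredReducesToUniformBarlow (for such stacks the energy is minimised at hole offsets, by
AdjacentLayerHoleLocking + the k ≥ 2 Bessel terms, and at uniform spacing, by convexity) →
PeriodicReductionToBarlow; this needs one new object (LayeredStacking a (z u : ℤ → …), a definition
request at split time, not now). LjRegistryDomination ⇐ RegistryCouplingBesselTail (tail k ≥ 3) →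
SignAndSizeOfJ2 (certified 1-D quadrature of φ̂_{2h}(ξ₁), φ̂_{2h}(2ξ₁) on B) → LjRegistryDomination.
BulkDefectVanish ⇐ (CrystalKissingRigidity's SoftTwelveCoordination 0750, RobustFejesTothHales 0758)
+ StackingFaultBound 0759 with the fault cost |J₂|/2 from this route.

KILL CRITERIA. Refutation of LjRegistryDomination (a certified evaluation showing J₂ ≥ 0 or ratio <
2 somewhere on B) closes THIS route outright (close --reason refuted:LjRegistryDomination) and
revives RefuteCrystalPeriodicMin. Refutation of HcpPeriodicMinimiser by exhibiting a periodic Q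
below every relaxed HCP (e.g. FCC winning: needs J₂+J₄+… > 0, contradicting the sign structure)
closes the route and every HCP-targeted line. Refutation of PeriodicReductionToBarlow with HCP still
optimal is impossible (they are equivalent given D); refutation of AdjacentLayerHoleLocking at a box
corner forces a pivot to a smaller box around (0.971, 0.793) (route edit --restate with B' ⊂ B), not
a close. BulkDefectVanish refuted (persistent polytetrahedral bulk order in LJ ground states) kills
the positional half of every sphere-packing-heritage route; this route would then shrink to the
energetic conjunct (pivot: target HcpPeriodicMinimiser ∧ CrysEnergyLimit only, IsCrystallizing
re-sourced).

NOT DECOMPOSED YET. The layering of periodic competitors inside PeriodicReductionToBarlow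
(Flyspeck-type local inequality for periodic Q, hole-locking with k ≥ 2 corrections, spacing
convexity) — deliberately one blunt crux until LjRegistryDomination and AdjacentLayerHoleLocking
close; the explicit Poisson–Bessel identity for layerInteraction (a prover's --supports lemma:
Mathlib has Real.tsum_eq_tsum_fourierIntegral in 1-D and Bessel K only via integrals); the value of
(a₀,h₀) and e(HCP) (not needed: IsLeast is order-theoretic); the O(1) fault-plane count feeding
BulkDefectVanish (CrystalKissingRigidity's StackingFaultBound 0759); rotations/Wulff constants; the
pressure-induced HCP→FCC switch suggested by the sign change of φ̂_c at c ≈ 1.11 (outside the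
zero-pressure statement).

CHEAPEST FALSIFIER. A certified (interval) evaluation of J₂(a,h) and Σ_{k≥3}(k−1)|J_k(a,h)| at the
four corners of B — minutes of interval arithmetic on the one-term Bessel formula plus a two-shell
remainder bound; we ran the uncertified version (folder compute/box_scan.py, pure python, K_ν by
quadrature, cross-checked against direct lattice sums to 3e−10 at k = 2): J₂ ∈ [−1.5e−4, −3.68e−5]
and ratio ∈ [286.9, 587] on a 7×8 grid of B, all J_k < 0 for 2 ≤ k ≤ 12, hole = argmin of the
adjacent-layer registry potential at all corners. A refuter with kit interval arithmetic can confirm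
or kill LjRegistryDomination and AdjacentLayerHoleLocking in one job.

NUMBERS. a* (LJ hcp nearest-neighbour distance, r₀ = 1 units) = (A₁₂/A₆)^{1/6} ≈ 0.9712 (A₁₂ =
12.132, A₆ = 14.455); ideal h/a = √(2/3) = 0.8165; |ξ₁| = 2/(√3a) = 1.189; decay exponent per layer
2πh|ξ₁| = 5.92 (e^{−5.92} = 2.7e−3); J₁ = +0.782, J₂ = −7.2548e−5 (Bessel one-term −7.2549e−5;
direct sum R = 50: −7.2548e−5), J₃ = −8.45e−8, J₄ = −1.12e−10, J₅ = −1.7e−13; domination ratio 428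
at (a*, √(2/3)a*), worst 286.9 on B; fault cost per column ≥ |J₂|/2 ≥ 1.8e−5 on B; LoachAckland2017:
H₂ → −0.0009ε (= −7.5e−5 in tree units, ε = 1/12), H₃ two orders smaller; sign change of φ̂_c(ξ₁)
between c = 1.10 (+5.2e−5) and c = 1.12 (−1.1e−5).

DEFINITION REQUESTS. None at open (everything is typed over
BarlowStacking/BarlowStackingEnergy/HaggStacking/Crystallization). At split time: LayeredStacking
(stack of parallel triangular layers with free offsets/spacings) under
Summits/AtomisticToContinuum/Crystallization/Theorems, and possibly besselK ν z := ∫ t in Set.Ioi 0,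
exp(−z·cosh t)·cosh(ν t) under Literature/Analysis/SpecialFunctions if a prover wants the identity
as a named lemma.

Novelty: Searches (2026-08-15): lit search --hybrid "hcp fcc Lennard-Jones energy difference planewise
lattice sum Bessel stacking" (15 hits: BeterminSamajTravenec2022, Cicalese–Kreutz–Leonardi 2023
Wulff on fcc/hcp, textbooks — none with registry couplings); lit search (s2) "Lennard-Jones hcp fcc
energy difference lattice sum stacking" (14: Stillinger2001, Schwerdtfeger group
arXiv:2504.07338/2406.09635 exact Bessel/Terras lattice sums along cuboidal paths,
Jackson–Bruce–Ackland lattice-switch MC); lit galaxy search "planewise summation" --star all (7: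
Ewald/slab-geometry papers only), "stacking fault energy of Lennard-Jones" --star all (0); lit
frontier/bridges AtomisticToContinuum (kinetic-theory dominated, nothing on stacking); READ:
LoachAckland2017 arXiv:1708.01460 p.4 (registry chain H = H₀ + ΣH_nα_n; LJ H₂ → −0.0009ε, H₃ two
orders smaller ⇒ hcp; cutoff artefacts), BeterminPetrache2017 arXiv:1607.08716 Thm 1.1 + Example 2.6
(for every completely monotone f the aligned-minus-staggered layer sum is positive: FCC < HCP — the
one-signed case of the sign criterion), arXiv:2504.07338 App. A/E (Bessel expansions of LJ lattice
sums, no registry decomposition, no all-stackings statement); card + refuter audit add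
LennardjonesDent1928, Steele1973, Nijboer–de Wette (the tool), Barron–Domb 1955 (paywalled,
acq-01268), BurrowsEtAl2020 (fast lattice sums for hcp).
Nearest prior art found: LoachAckland2017 (registry-chain bookkeeping + the LJ numbers) and
BeterminPetrache2017 (layer positivi  [refs: 2504.07338, 1708.01460, 1607.08716, BeterminSamajTravenec2022, Stillinger2001, LoachAckland2017, BeterminPetrache2017, LennardjonesDent1928, Steele1973, BurrowsEtAl2020]

Barriers (technique_class: layer-poisson-summation, bessel-sign, hagg-reduction): - technique_class: layer-poisson-summation, bessel-sign, hagg-reduction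
- Literature.Barriers.AtomisticToContinuum.Hubbard1978_mostHomogeneous: APPLIES to any reduction to
a 1-D chain with infinite-range couplings (Sturmian/devil's-staircase ground states when scales
compete); evaded quantitatively — the LJ registry couplings decay like e^{−5.9k} with |J₂| ≥
287·Σ_{k≥3}(k−1)|J_k| on all of B, which is the hypothesis of the in-tree Peierls count
HaggDominationAllRanges forcing period 2; LjRegistryDomination is exactly the statement that the
competing scales do not exist.
- Literature.Barriers.AtomisticToContinuum.ShortRangeStackingBlindness: APPLIES to truncated
potentials (range < 2h sees no stacking); evaded because the mechanism IS the infinite tail: J₂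
lives at heights ≥ 2h ≥ 1.466 and its sign comes from −r⁻⁶ (the barrier's own evasion 'tail beyond
√(8/3)'); cutoff artefacts (LoachAckland2017, PartayOrtnerCsanyi2017) are explained, not suffered.
- Literature.Barriers.AtomisticToContinuum.KissingTwelveDegeneracy: APPLIES to the layering inputs
(PeriodicReductionToBarlow, BulkDefectVanish): twelve contacts never select a stacking; evaded as in
CrystalKissingRigidity — contact geometry is asked only for 'Barlow fragment', the stacking is
selected by the analytic tail (this route's engine), which is the barrier's listed evasion made
quantitative.
- Literature.Barriers.AtomisticToContinuum.FlexibleKissingArrangements: APPLIES to BulkDefectVanish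
through K2 (one soft twelve-she

Novelty grade: new-combination — refuter route-review gen-1 (rreview-39f6b731; gen-0 rreview-77be3272 + grounder g13-44 read). KEEP OPEN, no blocking objection; 13/13 decls rc0, refuter-stamped 13:50Z (check --route, per-item briefing there). ENGINE confirmed by a 3rd independent method (Poisson–Bessel series vs direct sums, 4.6e-1 (refuter refuter-rreview-route-AtomisticToContinu-39f6b731-0, 2026-08-15T13:52:31Z; prior: Steele1973 (Surf. Sci. 36, 317: Fourier–Bessel expansion of the 12-6 layer potential), LennardjonesDent1928, arXiv:1708.01460 (LoachAckland2017), arXiv:1607.08716 (BeterminPetrache2017 Thm 1.1), arXiv:1705.01751 (PartayOrtnerCsanyi2017), Stillinger2001, in-tree HaggStacking 0737)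

History (route lifecycle, newest last):
- 2026-08-16T03:49:04Z · AUTO-CRUX (backfill): HcpPeriodicMinimiser — hypotheses of the deciding theorem that nothing in the route derives are cruxes (operator:999:586464)
- 2026-08-23T18:52:14Z · DORMANT — reconciler: no traction for 6.2 d (last activity item-evidence-added at 2026-08-17T14:17:50Z); parked, not closed — `ledger route dormant route-AtomisticToConti (operator:999:101769)

sub-problem: Crystallization · status: dormant · opened planner-plancard-AtomisticToContinuum-Crystal-9775b641-0 2026-08-15T11:10:51Z · rev 2 · ledger route-AtomisticToContinuum-PoissonBesselStacking
GENERATED by the gate from the ledger (D-0016/17). Provers cite these decls: `theorem foo : Summit.AtomisticToContinuum.Crystallization.Theses.PoissonBesselStacking.<Decl> := …` in Summits/AtomisticToContinuum/Crystallization/Theorems/<Name>.lean.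
-/

namespace Summit.AtomisticToContinuum.Crystallization.Theses.PoissonBesselStacking

open scoped BigOperators Topology Manifold Classical MeasureTheory ProbabilityTheory Matrix InnerProductSpace ComplexConjugate ContinuousMap
open Filter Set Function TopologicalSpace MeasureTheory

attribute [summit_statement] _root_.Crystallization

/-- item stmt-AtomisticToContinuum-3061 · crux (kind.auto-crux: conjecture-grade) · rank 0 · open · by planner
why it might fail: False iff the LJ periodic ground state is not relaxed HCP: FCC wins only if J₂+J₄+… > 0 (numerics: J₂ = −7.25e−5 < 0, Stillinger2001 hcp at p = 0); a non-close-packed or non-uniformly relaxed polytype would have to gain > 3.6e−5 per layer.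
sources: Stillinger2001, PartayOrtnerCsanyi2017, BeterminSamajTravenec2022, LoachAckland2017, BlancLewin2015
[target] X_E: some relaxed HCP stacking with parameters (a,h) in the box B is a least element of the
Lennard-Jones energy per particle over all periodic configurations of ℝ³ (names the minimiser that
0627 leaves anonymous). -/
@[route_item "route-AtomisticToContinuum-PoissonBesselStacking", crux]
def HcpPeriodicMinimiser : Prop :=
  ∃ a h : ℝ, ∃ (ha : a ≠ 0) (hh : h ≠ 0), 47 / 50 ≤ a ∧ a ≤ 1 ∧ 39 / 50 * a ≤ h ∧ h ≤ 17 / 20 * a ∧ IsLeast (Set.range fun Q : Literature.MathematicalPhysics.StatisticalMechanics.PeriodicConfiguration 3 => Q.energyPerParticle Literature.MathematicalPhysics.StatisticalMechanics.lennardJones) ((Literature.MathematicalPhysics.StatisticalMechanics.hcpPeriodicConfiguration ha hh).energyPerParticle Literature.MathematicalPhysics.StatisticalMechanics.lennardJones)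

/-- item stmt-AtomisticToContinuum-3062 · crux · rank 2 · open · by planner
why it might fail: Given LjRegistryDomination it says relaxed HCP is THE periodic LJ minimiser: false if a non-close-packed or layer-wise relaxed polytype beats every uniform Barlow stacking in B; its proof is the periodic form of the whole energetic lower bound (Flyspeck-type local inequality).
sources: BlancLewin2015, FlatleyTheil2015, Hales2012, Stillinger2001, PartayOrtnerCsanyi2017, BeterminSamajTravenec2022
[crux] (R) ENERGETIC LAYERING/REDUCTION (card item (3), the genuinely 3-D content): for every
periodic configuration Q of ℝ³ there are (a,h) ∈ B and a periodic Hägg sequence s such that the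
uniform Barlow stacking barlowPeriodicConfiguration a h s has Lennard-Jones energy per particle ≤
that of Q. Intended mechanism (foreseen split): near-optimal periodic Q are twelve-coordinated
stacks of triangular layers (Flyspeck L12 cap + LJ bond counting, as in CrystalKissingRigidity K1/K2
but for PERIODIC Q, no N → ∞ defects), lateral offsets are forced into the deep holes by
AdjacentLayerHoleLocking, and layer-dependent spacings relax to a uniform h by convexity of h ↦
Φ_N(h) (the registry corrections are ≤ 7.3e−5 with dJ₂/dh ≈ 5e−4 against an O(10) stiffness:
non-uniform relaxation gains ≲ 1e−8 per layer). [deps: AdjacentLayerHoleLocking] [difficulty: XL] -/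
@[route_item "route-AtomisticToContinuum-PoissonBesselStacking", crux]
def PeriodicReductionToBarlow : Prop :=
  ∀ Q : Literature.MathematicalPhysics.StatisticalMechanics.PeriodicConfiguration 3, ∃ a h : ℝ, 47 / 50 ≤ a ∧ a ≤ 1 ∧ 39 / 50 * a ≤ h ∧ h ≤ 17 / 20 * a ∧ ∃ (s : ℤ → ℤ) (p : ℕ) (ha : a ≠ 0) (hh : h ≠ 0) (hp : p ≠ 0) (hs : ∀ i, s (i + p) = s i), Literature.MathematicalPhysics.StatisticalMechanics.IsHaggSeq s ∧ (Literature.MathematicalPhysics.StatisticalMechanics.barlowPeriodicConfiguration s ha hh hp hs).energyPerParticle Literature.MathematicalPhysics.StatisticalMechanics.lennardJones ≤ Q.energyPerParticle Literature.MathematicalPhysics.StatisticalMechanics.lennardJones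

/-- item stmt-AtomisticToContinuum-3063 · crux · rank 3 · closed · proved by Summit.AtomisticToContinuum.Crystallization.Theorems.PricedHcpWindowsLjRegistry.stub_ljRegistryDomination @ 3c3336003a98 (prover) · by planner
why it might fail: Only if the uncertified numerics are wrong at a box corner: the margin is a factor ≥ 287 (worst at a = 0.94, h/a = 0.78) and the sign of φ̂_c(ξ₁) flips at c ≈ 1.11 < 2h ≥ 1.466 on B; Mathlib lacks K_ν, so the by-hand route needs the integral representation.
sources: LennardjonesDent1928, Steele1973, LoachAckland2017, BeterminPetrache2017, BurrowsEtAl2020, FlatleyTheil2015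
[crux] (D) SIGN + HÄGG DOMINATION ON THE BOX (card items (1)-(2), the engine's deliverable): for all
(a,h) ∈ B, with J_k = barlowCoupling lennardJones a h k: Σ k|J_k| < ∞, J₂ < 0, and Σ_{k≥3}
(k−1)|J_k| ≤ |J₂|/2. Numerics (ours, Bessel series cross-checked by direct sums): worst ratio
|J₂|/Σ_{k≥3}(k−1)|J_k| = 286.9 at (a,h/a) = (0.94,0.78), 428 at the HCP optimum, max J₂ = −3.68e−5
at (1,0.85). Proof route: 2-D Poisson summation ⇒ J_k = (1/covol) Σ_{ξ∈Λ*∖0} φ̂_{kh}(ξ)(1 − cos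
2πξ·w) with φ̂_c(ξ) = (1/12)F₆ − (1/6)F₃, F_s(c,ξ) = (2π^s/Γ(s))(ξ/c)^{s−1}K_{s−1}(2πcξ); monotone
bounds K_ν(z) ≤ √(π/2z)e^{−z}(1 + (4ν²−1)/8z + …) and a certified sign of the one-dimensional
combination at ξ₁ (Mathlib-friendlier fallback: Abel transform + Paley–Wiener contour shift, or
direct interval lattice sums with an r⁻⁶ tail bound). This typed statement supersedes the informal
certified-computation items 0628/0670 and is exactly the hypothesis of HaggDominationAllRanges
(0737). [difficulty: L] -/
@[route_item "route-AtomisticToContinuum-PoissonBesselStacking", crux]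
def LjRegistryDomination : Prop :=
  ∀ a h : ℝ, 47 / 50 ≤ a → a ≤ 1 → 39 / 50 * a ≤ h → h ≤ 17 / 20 * a → Summable (fun k : ℕ => (k : ℝ) * |Literature.MathematicalPhysics.StatisticalMechanics.barlowCoupling Literature.MathematicalPhysics.StatisticalMechanics.lennardJones a h k|) ∧ Literature.MathematicalPhysics.StatisticalMechanics.barlowCoupling Literature.MathematicalPhysics.StatisticalMechanics.lennardJones a h 2 < 0 ∧ ∑' k : ℕ, (if 3 ≤ k then ((k : ℝ) - 1) * |Literature.MathematicalPhysics.StatisticalMechanics.barlowCoupling Literature.MathematicalPhysics.StatisticalMechanics.lennardJones a h k| else 0) ≤ (1 / 2) * |Literature.MathematicalPhysics.StatisticalMechanics.barlowCoupling Literature.MathematicalPhysics.StatisticalMechanics.lennardJones a h 2|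

/-- item stmt-AtomisticToContinuum-0751 · crux · rank 4 · open · by planner
why it might fail: Needs layering of finite ground states (K1/K2 of CrystalKissingRigidity, unproved; ε-quasi-12-neighbour constructions of Böröczky–Szabó 2016 threaten K2) plus O(1) fault planes; as typed P must be vertex-transitive — true for HCP, false for dhcp-type limits.
sources: Hales2012, BlancLewin2015, PartayOrtnerCsanyi2017, FlatleyTheil2015, LucaFriesecke2016, doi:10.1007/s10474-016-0583-4
[crux] HINGE: there is ONE periodic configuration P (the LJ-optimal HCP-type stacking, 0 ∈ motif)
such that for every window radius R and tolerance ε, in every sequence of LJ ground states all but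
o(N) particles i admit a linear isometry A with the particles in B_R(x_i) ε-matched both ways to x_i
+ A(P.points ∩ B_R). Follows from (K1) SoftTwelveCoordination + (K2) RobustFejesTothHales + (K3)
stacking selection (Hägg domination 0716/0737 + certified J_k) with ≤ K fault planes per ground
state. Sources: Hales2012 Thm 1; HaggStacking.lean; PartayOrtnerCsanyi2017. -/
@[route_item "route-AtomisticToContinuum-PoissonBesselStacking", crux]
def BulkDefectVanish : Prop :=
  ∃ P : Literature.MathematicalPhysics.StatisticalMechanics.PeriodicConfiguration 3, ∀ R ε : ℝ, 0 < R → 0 < ε → ∀ x : (N : ℕ) → (Fin N → EuclideanSpace ℝ (Fin 3)), (∀ N, Literature.MathematicalPhysics.StatisticalMechanics.IsGroundState Literature.MathematicalPhysics.StatisticalMechanics.lennardJones (x N)) → Filter.Tendsto (fun N : ℕ => (Nat.card {i : Fin N // ¬ ∃ A : EuclideanSpace ℝ (Fin 3) →ₗᵢ[ℝ] EuclideanSpace ℝ (Fin 3), (∀ p ∈ P.points, ‖p‖ ≤ R → ∃ j : Fin N, dist (x N j) (x N i + A p) ≤ ε) ∧ (∀ j : Fin N, dist (x N j) (x N i) ≤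 R → ∃ p ∈ P.points, dist (x N j) (x N i + A p) ≤ ε)} : ℝ) / N) Filter.atTop (nhds 0)

/-- item stmt-AtomisticToContinuum-3064 · crux · rank 5 · open · by planner
why it might fail: V(√(|y|²+h²)) is a DIFFERENCE of completely monotone functions of |y|²: Baernstein's theorem pulls the r⁻¹² part to the holes but the −r⁻⁶ part to the atop site; the second dual shell weighs ≈10% of the first at c = h, so global (not just local) minimality needs a quantitative argument.
sources: Baernstein1997, BeterminPetrache2017, LennardjonesDent1928, Steele1973
[crux] (k = 1 term of the engine) For all (a,h) ∈ B the registry potential of ONE adjacent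
triangular layer at height h, u ↦ Φ_h(u) = Σ_{λ∈Λ_a} V_LJ(√(|λ+u|²+h²)), is minimised over all
lateral offsets u ∈ ℝ² at the deep hole w = (a/2, a√3/6) (where it equals layerInteraction
lennardJones a h 1 1). Poisson: Φ_h(u) = const + (1/covol)Σ_{ξ≠0} φ̂_h(ξ)cos(2πξ·u) with φ̂_h(ξ₁) >
0 on B (repulsion-dominated at c = h ≤ 0.85 < 1.10), and the first-shell sum Σ_6 cos(2πξ·u) is
minimised exactly at the two holes; numerics: argmin = hole at all four box corners (hole −0.3874 vs
bridge −0.3422 vs atop +0.29 at (0.94,0.85)). Used by PeriodicReductionToBarlow (offsets of layered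
competitors) and by the positional layering. [difficulty: M] -/
@[route_item "route-AtomisticToContinuum-PoissonBesselStacking", crux]
def AdjacentLayerHoleLocking : Prop :=
  ∀ a h : ℝ, 47 / 50 ≤ a → a ≤ 1 → 39 / 50 * a ≤ h → h ≤ 17 / 20 * a → ∀ u₁ u₂ : ℝ, Literature.MathematicalPhysics.StatisticalMechanics.layerInteraction Literature.MathematicalPhysics.StatisticalMechanics.lennardJones a h 1 1 ≤ ∑' ij : ℤ × ℤ, Literature.MathematicalPhysics.StatisticalMechanics.lennardJones (Real.sqrt ((a * ((ij.1 : ℝ) + (ij.2 : ℝ) / 2) + u₁) ^ 2 + (a * Real.sqrt 3 / 2 * (ij.2 : ℝ) + u₂) ^ 2 + h ^ 2))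

/-- item stmt-AtomisticToContinuum-0626 · support · rank 9 · closed · proved by Summit.AtomisticToContinuum.Crystallization.Theorems.crysEnergyLimit_proof @ de27d46e58f4 (prover) · by planner
sources: BlancLewin2015
Energetic crystallization: E(N)/N converges to the infimum over periodic (multi-lattice)
configurations of the LJ energy per particle in d = 3. Lower bound liminf ≥ ⨅ is the content ((a)
local optimality + (d) + surface term O(N^{2/3})); upper bound is filed separately. -/
@[route_item "route-AtomisticToContinuum-PoissonBesselStacking", crux]
def CrysEnergyLimit : Prop :=
  Filter.Tendsto (fun N : ℕ => Literature.MathematicalPhysics.StatisticalMechanics.groundStateEnergy Literature.MathematicalPhysics.StatisticalMechanics.lennardJones 3 N / N) Filter.atTop (nhds (⨅ Q : Literature.MathematicalPhysics.StatisticalMechanics.PeriodicConfiguration 3, Q.energyPerParticle Literature.MathematicalPhysics.StatisticalMechanics.lennardJones))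

/-- `CrysEnergyLimit` holds: proved by `Summit.AtomisticToContinuum.Crystallization.Theorems.crysEnergyLimit_proof` @ de27d46e58f4. -/
theorem CrysEnergyLimit_holds : CrysEnergyLimit := _root_.Summit.AtomisticToContinuum.Crystallization.Theorems.crysEnergyLimit_proof

/-- item stmt-AtomisticToContinuum-0737 · support · rank 9 · open · by planner
sources: RadinSchulman1983, PartayOrtnerCsanyi2017
HÄGG DOMINATION, ALL RANGES, ARBITRARY (non-periodic) Hägg sequence, finite volume with O(1)
boundary term — the Mathlib-only core from which 0671 (typed: alternatingHagg minimises
haggStackingEnergy over all Hägg sequences under summable domination) follows by dividing by n and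
taking liminf (haggStackingEnergy_alternating = tsum of even J_k is in HaggStacking.lean).
Statement: for J with Σ k|J_k| < ∞ and J_2 + Σ_{k≥3}(k−1)|J_k| ≤ 0, every ±1 sequence s and every n:
n·Σ_{k≥2 even} J_k ≤ H_n(J,s) + Σ_k k|J_k|, where H_n(J,s) = Σ_{m<n} Σ'_{k≥2} J_k·1[s_m+…+s_{m+k−1}
≡ 0 mod 3] (= Literature.MathematicalPhysics.StatisticalMechanics.haggEnergy n J s definitionally).
Proof (Peierls count as in 0716, refuters g2-0/g2-1/g3-2): b := #{m<n : s(m+1) = s(m)}; k = 2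
contributes exactly J_2(n − b); for k ≥ 3 a window m..m+k−1 with all internal bonds in [0,n) and
none bad is alternating, hence aligned iff k even; windows m<n containing a bad internal bond j<n
number ≤ (k−1)b, windows with an internal bond ≥ n number ≤ k−1; so |A_k − n[k even]| ≤ (k−1)(b+1)
and RHS − LHS ≥ b(−J_2 − Σ_{k≥3}(k−1)|J_k|) − Σ_{k≥3}(k−1)|J_k| ≥ −Σ_k k|J_k|. Extends 0716 (finite
K, periodic s) to K = ∞ and aperiodic s; -/
@[route_item "route-AtomisticToContinuum-PoissonBesselStacking", crux]
def HaggDominationAllRanges : Prop :=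
  ∀ (J : ℕ → ℝ) (s : ℤ → ℤ) (n : ℕ), (∀ i, s i = 1 ∨ s i = -1) → Summable (fun k : ℕ => (k : ℝ) * |J k|) → J 2 + ∑' k : ℕ, (if 3 ≤ k then ((k : ℝ) - 1) * |J k| else 0) ≤ 0 → (n : ℝ) * ∑' k : ℕ, (if 2 ≤ k ∧ Even k then J k else 0) ≤ (∑ m ∈ Finset.range n, ∑' k : ℕ, (if 2 ≤ k ∧ (∑ i ∈ Finset.range k, s ((m : ℤ) + i)) % 3 = 0 then J k else 0)) + ∑' k : ℕ, (k : ℝ) * |J k|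

/-- item stmt-AtomisticToContinuum-0752 · support · rank 9 · closed · proved by Summit.AtomisticToContinuum.Crystallization.Theorems.ThreeConeCertificateDefectVanishCrystallizes.defectVanishCrystallizes_proof (prover) · by planner
sources: BlancLewin2015
[support] SOFT ASSEMBLY LEMMA: BulkDefectVanish together with the uniform minimal distance of LJ
ground states (Literature fact LennardJonesMinimalDistance, Xue 1997 / BlancLewin2015 §2.2) implies
IsCrystallizing lennardJones 3: pick, for R_k = k, ε_k = 1/k, indices N_k ↑ and good particles i_k;
τ_k = −x_{i_k}; extract a convergent subsequence of the isometries A_k → A in O(3); minimal distance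
+ discreteness of P make the ε-matching a local bijection, so Σ_i f(x_i + τ_k) → Σ_{s ∈ A(P.points)}
f(s) for f ∈ C_c; A(P) is again a PeriodicConfiguration (rotate lattice and motif), multiplicity m ≡
1. -/
@[route_item "route-AtomisticToContinuum-PoissonBesselStacking", crux]
def DefectVanishCrystallizes : Prop :=
  BulkDefectVanish → Literature.MathematicalPhysics.StatisticalMechanics.LennardJonesMinimalDistance → Literature.MathematicalPhysics.StatisticalMechanics.IsCrystallizing Literature.MathematicalPhysics.StatisticalMechanics.lennardJones 3

/-- `DefectVanishCrystallizes` holds: proved by `Summit.AtomisticToContinuum.Crystallization.Theorems.ThreeConeCertificateDefectVanishCrystallizes.defectVanishCrystallizes_proof`. -/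
theorem DefectVanishCrystallizes_holds : DefectVanishCrystallizes := _root_.Summit.AtomisticToContinuum.Crystallization.Theorems.ThreeConeCertificateDefectVanishCrystallizes.defectVanishCrystallizes_proof

/-- item stmt-AtomisticToContinuum-3065 · support · rank 9 · closed · proved by Summit.AtomisticToContinuum.Crystallization.Theorems.PricedHcpWindowsBarlowEnergy.stub_barlowEnergyIdentification @ bf3f020dee6e (prover) · by planner
sources: BlancLewin2015, PartayOrtnerCsanyi2017
[support] the regrouping left open in BarlowStackingEnergy.lean ('Not proved here'): for a, h > 0
and a p-periodic Hägg sequence s, the energy per particle (Crystallization.lean, tsum over the point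
set) of barlowPeriodicConfiguration a h s equals barlowBaseEnergy lennardJones a h + haggEnergy p
(barlowCoupling lennardJones a h) s / p (absolute summability of the LJ lattice sum,
PeriodicConfigurationSums.lean, + barlowSiteEnergy_average_eq_haggEnergy + motif card = p).
[difficulty: provable-now] -/
@[route_item "route-AtomisticToContinuum-PoissonBesselStacking", crux]
def BarlowEnergyIdentification : Prop :=
  ∀ a h : ℝ, 0 < a → 0 < h → ∀ (s : ℤ → ℤ) (p : ℕ) (ha : a ≠ 0) (hh : h ≠ 0) (hp : p ≠ 0) (hs : ∀ i, s (i + p) = s i), Literature.MathematicalPhysics.StatisticalMechanics.IsHaggSeq s → (Literature.MathematicalPhysics.StatisticalMechanics.barlowPeriodicConfiguration s ha hh hp hs).energyPerParticle Literature.MathematicalPhysics.StatisticalMechanics.lennardJones = Literature.MathematicalPhysics.StatisticalMechanics.barlowBaseEnergy Literature.MathematicalPhysics.StatisticalMechanics.lennardJones a h + Literature.MathematicalPhysics.StatisticalMechanics.haggEnergy p (Literature.MathematicalPhysics.StatisticalMechanics.barlowCoupling Literature.MathematicalPhysics.StatisticalMechanics.lennardJones a h) s / p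

/-- item stmt-AtomisticToContinuum-3066 · support · rank 9 · open · by planner
sources: BlancLewin2015, BeterminSamajTravenec2022
[support] continuity/compactness: (a,h) ↦ energyPerParticle lennardJones (hcpPeriodicConfiguration a
h) attains its minimum over the compact box B at some (a₀,h₀) ∈ B (uniform convergence of the LJ
lattice sums on B). [difficulty: provable-now] -/
@[route_item "route-AtomisticToContinuum-PoissonBesselStacking", crux]
def HcpEnergyMinOnBox : Prop :=
  ∃ a₀ h₀ : ℝ, ∃ (ha₀ : a₀ ≠ 0) (hh₀ : h₀ ≠ 0), 47 / 50 ≤ a₀ ∧ a₀ ≤ 1 ∧ 39 / 50 * a₀ ≤ h₀ ∧ h₀ ≤ 17 / 20 * a₀ ∧ ∀ a h : ℝ, ∀ (ha : a ≠ 0) (hh : h ≠ 0), 47 / 50 ≤ a → a ≤ 1 → 39 / 50 * a ≤ h → h ≤ 17 / 20 * a → (Literature.MathematicalPhysics.StatisticalMechanics.hcpPeriodicConfiguration ha₀ hh₀).energyPerParticle Literature.MathematicalPhysics.StatisticalMechanics.lennardJones ≤ (Literature.MathematicalPhysics.StatisticalMechanics.hcpPeriodicConfiguration ha hh).energyPerParticle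 Literature.MathematicalPhysics.StatisticalMechanics.lennardJones

/-- item stmt-AtomisticToContinuum-3067 · support · rank 9 · open · by planner
sources: RadinSchulman1983, BlancLewin2015
[support] glue of the energetic half: PeriodicReductionToBarlow → LjRegistryDomination →
HaggDominationAllRanges → BarlowEnergyIdentification → HcpEnergyMinOnBox → HcpPeriodicMinimiser.
Proof: for any Q take the Barlow competitor (R); by (E) its energy is e₀(a,h) + H_p/p; periodicity
gives H_{pm} = m·H_p (haggLocalEnergy_periodic), so by (H) with the hypothesis supplied by (D),
H_p/p ≥ Σ_{k even} J_k − Σ k|J_k|/(pm) → Σ_{k even} J_k; by (E) with alternatingHagg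
(haggEnergy_alternating) this is e(hcp a h) ≥ e(hcp a₀ h₀) by (M); hcp a₀ h₀ is itself periodic,
hence IsLeast. [difficulty: S] -/
@[route_item "route-AtomisticToContinuum-PoissonBesselStacking", crux]
def EnergeticGlue : Prop :=
  PeriodicReductionToBarlow → LjRegistryDomination → HaggDominationAllRanges → BarlowEnergyIdentification → HcpEnergyMinOnBox → HcpPeriodicMinimiser

/-- item stmt-AtomisticToContinuum-3068 · support · rank 9 · open · by planner
sources: LennardjonesDent1928, Steele1973, BurrowsEtAl2020, arXiv:2504.07338
[support] the engine's structural output (refutes the 'J_k ~ k⁻⁴' premise of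
RefuteCrystalPeriodicMin): for all (a,h) ∈ B and all k ≥ 2, J_k = barlowCoupling lennardJones a h k
is NEGATIVE and |J_k| ≤ 20·exp(−(4π/√3)(h/a)k) (numerics: sup over B and 2 ≤ k ≤ 12 of
|J_k|e^{(4π/√3)(h/a)k} = 11.8, attained at k = 2, (a,h/a) = (0.94,0.78); the prefactor decays like
k^{−5/2}). Implies the summability and tail parts of LjRegistryDomination. Tool: 2-D Poisson
summation, FT[(|y|²+c²)^{−s}](ξ) = (2π^s/Γ(s))(|ξ|/c)^{s−1}K_{s−1}(2πc|ξ|), K_ν(z) = ∫₀^∞ e^{−z cosh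
t}cosh(νt)dt. [difficulty: M] -/
@[route_item "route-AtomisticToContinuum-PoissonBesselStacking", crux]
def RegistryCouplingBesselTail : Prop :=
  ∀ a h : ℝ, 47 / 50 ≤ a → a ≤ 1 → 39 / 50 * a ≤ h → h ≤ 17 / 20 * a → ∀ k : ℕ, 2 ≤ k → Literature.MathematicalPhysics.StatisticalMechanics.barlowCoupling Literature.MathematicalPhysics.StatisticalMechanics.lennardJones a h k < 0 ∧ |Literature.MathematicalPhysics.StatisticalMechanics.barlowCoupling Literature.MathematicalPhysics.StatisticalMechanics.lennardJones a h k| ≤ 20 * Real.exp (-(4 * Real.pi / Real.sqrt 3) * (h / a) * k)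

/-- item stmt-AtomisticToContinuum-3069 · assembly · rank 1 · open · by planner
sources: BlancLewin2015
[assembly] HcpPeriodicMinimiser → CrysEnergyLimit → BulkDefectVanish → DefectVanishCrystallizes →
LennardJonesMinimalDistance → Crystallization -/
@[route_item "route-AtomisticToContinuum-PoissonBesselStacking", crux]
def Assembly : Prop :=
  HcpPeriodicMinimiser → CrysEnergyLimit → BulkDefectVanish → DefectVanishCrystallizes → Literature.MathematicalPhysics.StatisticalMechanics.LennardJonesMinimalDistance → Crystallization

/-! D-0027 §2.1 — DECIDING THEOREM (planner-authored via `route open/edit --closes-file`; by planner-rbadge-AtomisticToContinuum-PoissonBes-a4741b98-g2-0 2026-08-15T16:13:13Z):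
its hypotheses are this route's items and its conclusion the sub-problem Statement (glue_lint), and it elaborates with this file. -/

@[closes "route-AtomisticToContinuum-PoissonBesselStacking"] theorem closes : HcpPeriodicMinimiser → PeriodicReductionToBarlow → LjRegistryDomination → BulkDefectVanish →
    AdjacentLayerHoleLocking → CrysEnergyLimit → HaggDominationAllRanges → DefectVanishCrystallizes →
    BarlowEnergyIdentification → HcpEnergyMinOnBox → EnergeticGlue → RegistryCouplingBesselTail → Assembly →
    _root_.Crystallization := by
  intro h_HcpPeriodicMinimiser h_PeriodicReductionToBarlow h_LjRegistryDomination h_BulkDefectVanish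
    h_AdjacentLayerHoleLocking h_CrysEnergyLimit h_HaggDominationAllRanges h_DefectVanishCrystallizes
    h_BarlowEnergyIdentification h_HcpEnergyMinOnBox h_EnergeticGlue h_RegistryCouplingBesselTail h_Assembly
  -- energetic half X_E: the cruxes (R), (D) and the supports (H), (E), (M) compose into the target
  -- HcpPeriodicMinimiser through the glue item EnergeticGlue (the target hypothesis and `Assembly` are not used)
  have hX : HcpPeriodicMinimiser :=
    h_EnergeticGlue h_PeriodicReductionToBarlow h_LjRegistryDomination h_HaggDominationAllRanges
      h_BarlowEnergyIdentification h_HcpEnergyMinOnBox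
  obtain ⟨a, h, ha, hh, -, -, -, -, hleast⟩ := hX
  -- the periodic minimum is attained at relaxed HCP, so ⨅_Q e(Q) = e(hcp a h) (IsLeast.csInf_eq)
  have hinf : (⨅ Q : Literature.MathematicalPhysics.StatisticalMechanics.PeriodicConfiguration 3,
      Q.energyPerParticle Literature.MathematicalPhysics.StatisticalMechanics.lennardJones) =
      (Literature.MathematicalPhysics.StatisticalMechanics.hcpPeriodicConfiguration ha hh).energyPerParticle
        Literature.MathematicalPhysics.StatisticalMechanics.lennardJones :=
    hleast.csInf_eq
  -- CrysEnergyLimit: E(N)/N → ⨅_Q e(Q), rewritten to e(hcp a h)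
  have hlim : Filter.Tendsto
      (fun N : ℕ => Literature.MathematicalPhysics.StatisticalMechanics.groundStateEnergy
        Literature.MathematicalPhysics.StatisticalMechanics.lennardJones 3 N / N) Filter.atTop
      (nhds ((Literature.MathematicalPhysics.StatisticalMechanics.hcpPeriodicConfiguration ha hh).energyPerParticle
        Literature.MathematicalPhysics.StatisticalMechanics.lennardJones)) := by
    have h0 : CrysEnergyLimit := h_CrysEnergyLimit
    unfold CrysEnergyLimit at h0
    rw [hinf] at h0
    exact h0
  -- positional half X_P: the hinge BulkDefectVanish + DefectVanishCrystallizes, with the PROVED Literature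
  -- theorem LennardJonesMinimalDistance_holds (δ = 1/3) discharged inside the proof (no extra hypothesis)
  have hpos : Literature.MathematicalPhysics.StatisticalMechanics.IsCrystallizing
      Literature.MathematicalPhysics.StatisticalMechanics.lennardJones 3 :=
    h_DefectVanishCrystallizes h_BulkDefectVanish
      Literature.MathematicalPhysics.StatisticalMechanics.LennardJonesMinimalDistance_holds
  -- Crystallization = HasPeriodicGroundStateEnergy lennardJones 3 ∧ IsCrystallizing lennardJones 3
  exact ⟨⟨Literature.MathematicalPhysics.StatisticalMechanics.hcpPeriodicConfiguration ha hh, hleast, hlim⟩, hpos⟩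

end Summit.AtomisticToContinuum.Crystallization.Theses.PoissonBesselStacking
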